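import Summits.RiemannHypothesis.RiemannHypothesis.Theorems.Splittings.PrimeWindowBlindnessKreinA

/-!
# Removal-only exact theft is impossible for finite off-line configurations (`KreinFailsFinite`) — part B of 2

§§4–5 of rh-split-screw-bridge g19's K6 object (`PrimeWindowBlindnessKrein.lean` 6d6819e976b7acdc · 543 l, carved at
the §3/§4 boundary for the gate's 400-line limit; part A = `PrimeWindowBlindnessKreinA.lean` holds §§1–3 and the module
docstring of record): (K6a) `momentMatch_of_window`, `RemovalOnlyTheft`, `StrictOffLine`, (K6b) `kreinFailsFinite`,
(K6c) `RemovalOnlyTheftNoGoFinite` / `_holds`, S2 `StrictOffLine.psi_not_zero_on_window`; §5 controls (`quadTerm_onLine`,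
S1 tightness `removalOnlyTheft_onLineAtom`, `momentMatch_onLineAtom`, non-vacuity, J = 1 Hankel determinant).
B33 Q_C clause 1 «REMOVAL-ONLY: NO» for FINITE configurations; the countable-removal bridge and clause 3 (K7′) are NOT
decided here.  Elementary; ζ-free and RH-free; nothing here bears on the truth of RH.
-/

set_option linter.dupNamespace false

namespace Summit.RiemannHypothesis.RiemannHypothesis.Theorems.Splittings.PrimeWindowBlindnessKrein

open Polynomial
open Summit.RiemannHypothesis.RiemannHypothesis.Theorems.Splittings.ScrewLatticeTower
open Summit.RiemannHypothesis.RiemannHypothesis.Theorems.Splittings.ScrewLatticeWolff (quadTerm)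
open Summit.RiemannHypothesis.RiemannHypothesis.Theorems.Splittings.SlidingGerm (pairTrace)

variable {α β : Type*}

/-! ## 4. Window equality ⇒ moment match; REMOVAL-ONLY EXACT THEFT: NO -/

/-- **(K6a, finite bridge) `momentMatch_of_window`**: if the finite off-line trace `Σ_a quadTerm m_a κ_a` and a
finite removal trace `Σ_k n_k · pairTrace g_k` agree on a window `|t| < U` (`U > 0`), their moments match at
every order. -/
theorem momentMatch_of_window (s : Finset α) (m : α → ℝ) (κ : α → ℂ) (r : Finset ℕ) (n g : ℕ → ℝ)
    {U : ℝ} (hU : 0 < U) (hκ : ∀ a ∈ s, κ a ≠ 0) (hg : ∀ k ∈ r, g k ≠ 0)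
    (h : ∀ t : ℝ, |t| < U → ∑ a ∈ s, quadTerm (m a) (κ a) t = ∑ k ∈ r, n k * pairTrace (g k) t)
    (N₀ : ℕ) : MomentMatch s m κ r n g N₀ := by
  classical
  intro N _
  have hw : ∀ t : ℝ, |t| < U →
      finExpSum (s ×ˢ (Finset.univ : Finset (Fin 6))) (fun p ↦ offA (m p.1) (κ p.1) p.2)
          (fun p ↦ offB (κ p.1) p.2) t
        = finExpSum (r ×ˢ (Finset.univ : Finset (Fin 3))) (fun p ↦ remA (n p.1) (g p.1) p.2)
          (fun p ↦ remB (g p.1) p.2) t := by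
    intro t ht
    rw [finExpSum, finExpSum, Finset.sum_product, Finset.sum_product]
    calc ∑ a ∈ s, ∑ j : Fin 6, offA (m a) (κ a) j * Complex.exp (offB (κ a) j * t)
        = ∑ a ∈ s, (quadTerm (m a) (κ a) t : ℂ) :=
          Finset.sum_congr rfl fun a ha ↦ (quadTerm_eq_finExpSum (m a) (hκ a ha) t).symm
      _ = ((∑ a ∈ s, quadTerm (m a) (κ a) t : ℝ) : ℂ) := (Complex.ofReal_sum _ _).symm
      _ = ((∑ k ∈ r, n k * pairTrace (g k) t : ℝ) : ℂ) := by rw [h t ht]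
      _ = ∑ k ∈ r, ((n k * pairTrace (g k) t : ℝ) : ℂ) := Complex.ofReal_sum _ _
      _ = ∑ k ∈ r, ∑ j : Fin 3, remA (n k) (g k) j * Complex.exp (remB (g k) j * t) :=
          Finset.sum_congr rfl fun k hk ↦ pairTrace_eq_finExpSum (n k) (hg k hk) t
  have hm := expMoment_eq_of_window hU hw (2 * N + 2)
  rw [Finset.sum_product, Finset.sum_product] at hm
  have hL : ∑ a ∈ s, ∑ j : Fin 6, offA (m a) (κ a) j * offB (κ a) j ^ (2 * N + 2) = offMoment s m κ N :=
    Finset.sum_congr rfl fun a ha ↦ offA_mul_offB_pow (m a) (hκ a ha) N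
  have hR : ∑ k ∈ r, ∑ j : Fin 3, remA (n k) (g k) j * remB (g k) j ^ (2 * N + 2)
      = (remMoment r n g N : ℂ) := by
    rw [remMoment, Complex.ofReal_sum]
    exact Finset.sum_congr rfl fun k hk ↦ remA_mul_remB_pow (n k) (hg k hk) N
  rw [← hL, ← hR]
  exact hm

/-- REMOVAL-ONLY EXACT THEFT of a configuration `Z` on the window `|t| < U` by finitely many on-line pairs
(multiplicities `n_k ≥ 0`, heights `g_k > 0`): the removed pairs' trace reproduces `Ψ_Z` exactly there. -/
def RemovalOnlyTheft (U : ℝ) (Z : Config) (r : Finset ℕ) (n g : ℕ → ℝ) : Prop :=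
  (∀ k ∈ r, 0 ≤ n k) ∧ (∀ k ∈ r, 0 < g k) ∧
    ∀ t : ℝ, |t| < U → Z.psi t = ∑ k ∈ r, n k * pairTrace (g k) t

/-- A STRICTLY OFF-LINE configuration: weights `≥ 0` and not all zero, and every atom of positive weight (in
EITHER family) has `Re κ > 0` and `Im κ > 0`, so its node `κ²` is off the real axis. -/
structure StrictOffLine (Z : Config) : Prop where
  m_nonneg : ∀ i, 0 ≤ Z.m₁ i ∧ 0 ≤ Z.m₂ i
  nontrivial : ∃ i, 0 < Z.m₁ i ∨ 0 < Z.m₂ i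
  off₁ : ∀ i, 0 < Z.m₁ i → 0 < (Z.κ₁ i).re ∧ 0 < (Z.κ₁ i).im
  off₂ : ∀ i, 0 < Z.m₂ i → 0 < (Z.κ₂ i).re ∧ 0 < (Z.κ₂ i).im

/-- **(K6b) `kreinFailsFinite` — REMOVAL-ONLY EXACT THEFT: NO**, for every FINITE strictly off-line
configuration, on every window `|t| < U`, `U > 0` (theory-1 25.12 (B); B33 Q_C clause 1 for finite `Z`). -/
theorem kreinFailsFinite {Z : Config} [Fintype Z.ι] (hZ : StrictOffLine Z) {U : ℝ} (hU : 0 < U)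
    (r : Finset ℕ) (n g : ℕ → ℝ) : ¬ RemovalOnlyTheft U Z r n g := by
  classical
  rintro ⟨hn, hg, hwin⟩
  -- atoms of both families, restricted to positive weight
  set mA : Z.ι ⊕ Z.ι → ℝ := Sum.elim Z.m₁ Z.m₂ with hmA
  set κA : Z.ι ⊕ Z.ι → ℂ := Sum.elim Z.κ₁ Z.κ₂ with hκA
  set s : Finset (Z.ι ⊕ Z.ι) := Finset.univ.filter fun a ↦ 0 < mA a with hs
  have hs_mem : ∀ a, a ∈ s ↔ 0 < mA a := fun a ↦ by simp [hs]
  have hmA0 : ∀ a, 0 ≤ mA a := by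
    rintro (i | i)
    · exact (hZ.m_nonneg i).1
    · exact (hZ.m_nonneg i).2
  have hoff : ∀ a ∈ s, 0 < (κA a).re ∧ 0 < (κA a).im := by
    intro a ha
    have ha' := (hs_mem a).1 ha
    rcases a with i | i
    · exact hZ.off₁ i ha'
    · exact hZ.off₂ i ha'
  have hκ0 : ∀ a ∈ s, κA a ≠ 0 := by
    intro a ha h0
    have := (hoff a ha).1
    rw [h0, Complex.zero_re] at this
    exact lt_irrefl _ this
  have hκsq : ∀ a ∈ s, (κA a ^ 2).im ≠ 0 := by
    intro a ha
    obtain ⟨hre, him⟩ := hoff a ha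
    have e : (κA a ^ 2).im = 2 * (κA a).re * (κA a).im := by rw [sq, Complex.mul_im]; ring
    rw [e]
    positivity
  have hm : ∀ a ∈ s, 0 ≤ mA a := fun a _ ↦ hmA0 a
  have hpos : ∃ a ∈ s, 0 < mA a := by
    obtain ⟨i, hi | hi⟩ := hZ.nontrivial
    · exact ⟨Sum.inl i, (hs_mem _).2 hi, hi⟩
    · exact ⟨Sum.inr i, (hs_mem _).2 hi, hi⟩
  -- `Ψ_Z` is the finite sum of the positive-weight atoms
  have hpsi : ∀ t : ℝ, Z.psi t = ∑ a ∈ s, quadTerm (mA a) (κA a) t := by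
    intro t
    have h1 : Z.psi t = ∑ a : Z.ι ⊕ Z.ι, quadTerm (mA a) (κA a) t := by
      show ∑' i, (quadTerm (Z.m₁ i) (Z.κ₁ i) t + quadTerm (Z.m₂ i) (Z.κ₂ i) t) = _
      rw [tsum_fintype, Fintype.sum_sum_type, ← Finset.sum_add_distrib]
      simp [hmA, hκA]
    rw [h1]
    refine (Finset.sum_subset (Finset.filter_subset _ _) fun a _ ha ↦ ?_).symm
    have h0 : mA a = 0 := le_antisymm (not_lt.mp fun h ↦ ha ((hs_mem a).2 h)) (hmA0 a)
    simp [quadTerm, h0]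
  have hwin' : ∀ t : ℝ, |t| < U →
      ∑ a ∈ s, quadTerm (mA a) (κA a) t = ∑ k ∈ r, n k * pairTrace (g k) t :=
    fun t ht ↦ by rw [← hpsi t]; exact hwin t ht
  exact kreinFailsFinite_moments s mA κA r n g hm hpos hκsq hn
    (momentMatch_of_window s mA κA r n g hU hκ0 (fun k hk ↦ (hg k hk).ne') hwin' _)

/-- **(K6c) record sentence in the vocabulary of #812 (`PrimeWindowBlindnessBarrierHolds`)**: Q_C clause 1
«REMOVAL-ONLY: NO» for FINITE configurations, as a closed `Prop`. -/
def RemovalOnlyTheftNoGoFinite : Prop :=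
  ∀ (Z : Config), Finite Z.ι → StrictOffLine Z → ∀ U : ℝ, 0 < U →
    ∀ (r : Finset ℕ) (n g : ℕ → ℝ), ¬ RemovalOnlyTheft U Z r n g

/-- (K6c) holds in the kernel. -/
theorem removalOnlyTheftNoGoFinite_holds : RemovalOnlyTheftNoGoFinite := by
  intro Z hfin hZ U hU r n g
  haveI := Fintype.ofFinite Z.ι
  exact kreinFailsFinite hZ hU r n g

/-- Corollary (`r = ∅`): a finite strictly off-line configuration is NOT prime-window invisible — `Ψ_Z` does not
vanish identically on any window `|t| < U`, `U > 0` (a lower record sentence; `PrimeWindowFootprint` has only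
upper bounds). -/
theorem StrictOffLine.psi_not_zero_on_window {Z : Config} [Fintype Z.ι] (hZ : StrictOffLine Z) {U : ℝ}
    (hU : 0 < U) : ¬ ∀ t : ℝ, |t| < U → Z.psi t = 0 := fun h ↦
  kreinFailsFinite hZ hU ∅ 0 0 ⟨by simp, by simp, fun t ht ↦ by simpa using h t ht⟩

/-! ## 5. Controls: the off-line hypothesis bites; non-vacuity -/

/-- NEGATIVE CONTROL (kernel): an ON-LINE atom `κ = i g` (`g ≠ 0`) is EXACTLY the trace of a removed on-line
pair of multiplicity `2m`: `quadTerm m (ig) t = 2m · pairTrace g t` for all `t`.  So `kreinFailsFinite` is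
false without the off-line hypothesis `Re κ > 0` (the node `κ² = −g²` is then real). -/
theorem quadTerm_onLine (m : ℝ) {g : ℝ} (hg : g ≠ 0) (t : ℝ) :
    quadTerm m ((g : ℂ) * Complex.I) t = 2 * m * pairTrace g t := by
  unfold quadTerm pairTrace
  have e : (Complex.cosh ((g : ℂ) * Complex.I * t) - 1) / ((g : ℂ) * Complex.I) ^ 2
      = (((1 - Real.cos (g * t)) / g ^ 2 : ℝ) : ℂ) := by
    rw [show (g : ℂ) * Complex.I * t = ((g * t : ℝ) : ℂ) * Complex.I by push_cast; ring,
      Complex.cosh_mul_I, ← Complex.ofReal_cos, mul_pow, Complex.I_sq]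
    have hg' : (g : ℂ) ≠ 0 := Complex.ofReal_ne_zero.mpr hg
    push_cast
    field_simp
    ring
  rw [e, Complex.ofReal_re]
  field_simp
  ring

/-- The single ON-LINE atom `κ = ig` of weight `m` (second family empty), as a configuration. -/
noncomputable def onLineAtom (m g : ℝ) : Config where
  ι := Unit
  m₁ := fun _ ↦ m
  m₂ := fun _ ↦ 0
  κ₁ := fun _ ↦ (g : ℂ) * Complex.I
  κ₂ := fun _ ↦ (g : ℂ) * Complex.I

/-- TIGHTNESS (theory-1 K6-SPEC §5 NEGCTL, kernel form): the on-line atom `κ = ig` of weight `m ≥ 0` IS stolen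
exactly, on EVERY window, by removing one on-line pair of multiplicity `2m` at height `g` — `RemovalOnlyTheft`
holds; so `StrictOffLine` (`Re κ > 0`) cannot be dropped from `kreinFailsFinite`. -/
theorem removalOnlyTheft_onLineAtom {m g : ℝ} (hm : 0 ≤ m) (hg : 0 < g) (U : ℝ) :
    RemovalOnlyTheft U (onLineAtom m g) {0} (fun _ ↦ 2 * m) (fun _ ↦ g) := by
  refine ⟨fun _ _ ↦ by positivity, fun _ _ ↦ hg, fun t _ ↦ ?_⟩
  show ∑' _ : Unit, (quadTerm m ((g : ℂ) * Complex.I) t + quadTerm 0 ((g : ℂ) * Complex.I) t) = _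
  rw [tsum_fintype, Finset.sum_singleton, quadTerm_onLine m hg.ne' t]
  simp [quadTerm]

/-- … and consequently its moments DO match at every order (the node `(ig)² = −g²` is real: the hypothesis
`Im κ² ≠ 0` of `kreinFailsFinite_moments` is the one that bites). -/
theorem momentMatch_onLineAtom {m g : ℝ} (hg : g ≠ 0) (N₀ : ℕ) :
    MomentMatch ({()} : Finset Unit) (fun _ ↦ m) (fun _ ↦ (g : ℂ) * Complex.I) {0} (fun _ ↦ 2 * m)
      (fun _ ↦ g) N₀ :=
  momentMatch_of_window _ _ _ _ _ _ zero_lt_one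
    (fun _ _ ↦ mul_ne_zero (Complex.ofReal_ne_zero.mpr hg) Complex.I_ne_zero) (fun _ _ ↦ hg)
    (fun t _ ↦ by rw [Finset.sum_singleton, Finset.sum_singleton, quadTerm_onLine m hg t]) N₀

/-- The single-atom configuration `{m = 1, κ = 1/4 + 14 i}` (second family empty). -/
noncomputable def oneAtom : Config where
  ι := Unit
  m₁ := fun _ ↦ 1
  m₂ := fun _ ↦ 0
  κ₁ := fun _ ↦ ⟨1 / 4, 14⟩
  κ₂ := fun _ ↦ ⟨1 / 4, 14⟩

/-- NON-VACUITY: `StrictOffLine` is inhabited by a finite configuration … -/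
theorem strictOffLine_oneAtom : StrictOffLine oneAtom where
  m_nonneg := fun _ ↦ by simp [oneAtom]
  nontrivial := ⟨(), Or.inl (by simp [oneAtom])⟩
  off₁ := fun _ _ ↦ by simp [oneAtom]
  off₂ := fun _ h ↦ by simp [oneAtom] at h

/-- … so the no-go theorem has an instance: no finite removal set steals `Ψ_{oneAtom}` exactly on any window. -/
theorem oneAtom_noTheft {U : ℝ} (hU : 0 < U) (r : Finset ℕ) (n g : ℕ → ℝ) :
    ¬ RemovalOnlyTheft U oneAtom r n g :=
  removalOnlyTheftNoGoFinite_holds oneAtom (inferInstanceAs (Finite Unit)) strictOffLine_oneAtom U hU r n g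

/-- J = 1 (one atom `κ = σ + iγ` of weight `m`): the `2 × 2` Hankel determinant of the off-line moments is
`M₀M₂ − M₁² = −64 m² σ² γ² < 0` — the one-line certificate that no positive real-node measure has these moments
(theory-1 K6-SPEC §3, J = 1). -/
theorem hankel_det_oneAtom (m σ γ : ℝ) :
    offMoment ({()} : Finset Unit) (fun _ ↦ m) (fun _ ↦ ⟨σ, γ⟩) 0
        * offMoment ({()} : Finset Unit) (fun _ ↦ m) (fun _ ↦ ⟨σ, γ⟩) 2
      - offMoment ({()} : Finset Unit) (fun _ ↦ m) (fun _ ↦ ⟨σ, γ⟩) 1 ^ 2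
      = ((-64 * m ^ 2 * σ ^ 2 * γ ^ 2 : ℝ) : ℂ) := by
  simp only [offMoment, Finset.sum_singleton, pow_zero, pow_one]
  apply Complex.ext <;> simp [sq, Complex.mul_re, Complex.mul_im, Complex.add_re, Complex.add_im] <;> ring

end Summit.RiemannHypothesis.RiemannHypothesis.Theorems.Splittings.PrimeWindowBlindnessKrein
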